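import Literature.Topology.FourManifolds.PalaisBallComplement
import HarnessLib

/-!
# Palais' disc theorem in spheres: every smooth disc is standard up to a diffeomorphism

Topic `Literature/Topology/FourManifolds` (trunk T-4MAN), companion to
`Literature.Topology.FourManifolds.PalaisBallComplement`. That file proves, inside the proof of
its ball-complement theorem `Literature.Topology.FourManifolds.hasComplementBall_of_isSmoothEmbedding`, the following form of
**Palais' disc theorem** (R. Palais, *Extending diffeomorphisms*, Proc. AMS 11 (1960), Thm. B;
M. W. Hirsch, *Differential Topology* (1976), Ch. 8, Thm. 3.1: any two smooth embeddings of the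
closed `n`-disc into a connected `n`-manifold which both preserve or both reverse orientation
are ambiently isotopic) on the unit sphere `S` of an `(n+1)`-dimensional real inner product
space `V`, but only records its consequence for complementary balls. Here the statement itself
is extracted, with the same proof:

* `Literature.Topology.FourManifolds.exists_diffeomorph_apply_stereographic_symm_eq` — for every smooth embedding
  `e : ℝⁿ → S` (Mathlib `Manifold.IsSmoothEmbedding (𝓡 n) (𝓡 n) ∞ e`) there are a
  diffeomorphism `Ψ` of `S` and a linear isometry `B` of `ℝⁿ` with
  `Ψ (σᵥ⁻¹ y) = e (B y)` for all `‖y‖ ≤ 1`, where `v = -e 0` and `σᵥ = stereographic' n v` is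
  Mathlib's stereographic chart from the pole `v` (so `σᵥ⁻¹ 0 = -v = e 0`). In words: up to a
  diffeomorphism of the sphere and an isometry of the disc, every smooth closed `n`-disc in `Sⁿ`
  is the standard (inverse stereographic) disc. The isometry `B ∈ O(n)` cannot be dropped (it
  absorbs the orientation behaviour of `e`; Palais' theorem proper identifies two disc
  embeddings only when they both preserve or both reverse orientation).
* `Literature.Topology.FourManifolds.exists_diffeomorph_apply_stereographic_symm_eq_of_isStraightenable` — the same under the
  technical hypotheses of `Literature.Topology.FourManifolds.hasComplementBall_of_isStraightenable` (pole `-v = e 0`,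
  straightenable derivative), with `B = 1`.

This is the input of the proof that a connected sum of two `n`-spheres is an `n`-sphere
(`Literature.Topology.FourManifolds.connectedSum_sphere_sphere`, `ConnectedSumSpheres.lean`; Kervaire–Milnor 1963, Lemma 2.1,
whose proof cites exactly "the lemma of Palais [20] and Cerf [5]").

## Proof

Verbatim the flow-free variant of Hirsch's proof implemented in `PalaisBallComplement.lean`
(see the module docstring there): with `v := -e 0`, `L := D(σᵥ ∘ e)(0)` is invertible; after an
isometry `B` of `ℝⁿ` (`exists_linearIsometryEquiv_isStraightenable_comp`) `L ∘ B` is compactly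
straightenable; `(L B)⁻¹ ∘ σᵥ ∘ e ∘ B` is tangent to the identity at `0`, hence agrees near `0`
with a compactly supported diffeomorphism `G` of `ℝⁿ` (`exists_diffeomorph_eq_of_fderiv_eq_id`);
realising `L B` and a contraction `r •` by compactly supported diffeomorphisms and transporting
them to `S` along the charts `σᵥ` and `e⁻¹` (`exists_diffeomorph_chartTransport`) produces `Ψ`.

## References

* R. Palais, *Extending diffeomorphisms*, Proc. AMS 11 (1960) 274–277, Thm. B. [Palais1960]
* M. W. Hirsch, *Differential Topology*, GTM 33 (1976), Ch. 8, §3, Thm. 3.1. [HirschDT1976]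
* M. Kervaire, J. Milnor, *Groups of homotopy spheres I*, Ann. of Math. 77 (1963), §2,
  Lemma 2.1 (the consumer). [KervaireMilnor1963]
-/

open scoped Manifold ContDiff Topology RealInnerProductSpace
open Function Set Metric Module

noncomputable section

namespace Literature.Topology.FourManifolds

variable {V : Type*} [NormedAddCommGroup V] [InnerProductSpace ℝ V] {n : ℕ}
  [Fact (finrank ℝ V = n + 1)]

/-- **Palais' disc theorem in a sphere — the straightenable case.** Let `e : ℝⁿ → S` be smooth,
the inverse of a chart `Φ` of `S` with target `ℝⁿ`, with `e 0 = -v`, and suppose the derivative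
`L` at `0` of `σᵥ ∘ e` is compactly straightenable. Then some diffeomorphism `Ψ` of `S` satisfies
`Ψ (σᵥ⁻¹ y) = e y` for `‖y‖ ≤ 1`: the standard disc `σᵥ⁻¹|𝔻ⁿ` is carried onto `e|𝔻ⁿ`. The proof
is that of `hasComplementBall_of_isStraightenable` (Hirsch (1976), Ch. 8, Thm. 3.1, flow-free
variant), stopped before its last step. [cite: HirschDT1976, Ch. 8 Thm. 3.1] [cite: Palais1960, Thm. B] -/
theorem exists_diffeomorph_apply_stereographic_symm_eq_of_isStraightenable
    {e : EuclideanSpace ℝ (Fin n) → sphere (0 : V) 1}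
    (hec : ContMDiff (𝓡 n) (𝓡 n) ∞ e)
    (Φ : OpenPartialHomeomorph (sphere (0 : V) 1) (EuclideanSpace ℝ (Fin n)))
    (hΦt : Φ.target = univ) (hΦe : ⇑Φ.symm = e)
    (hΦc : ContMDiffOn (𝓡 n) (𝓡 n) ∞ Φ Φ.source) {v : sphere (0 : V) 1} (hv : e 0 = -v)
    (L : EuclideanSpace ℝ (Fin n) ≃L[ℝ] EuclideanSpace ℝ (Fin n))
    (hL : HasFDerivAt (stereographic' n v ∘ e)
      (L : EuclideanSpace ℝ (Fin n) →L[ℝ] EuclideanSpace ℝ (Fin n)) 0)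
    (hLs : IsStraightenable (L : EuclideanSpace ℝ (Fin n) →L[ℝ] EuclideanSpace ℝ (Fin n))) :
    ∃ Ψ : (sphere (0 : V) 1) ≃ₘ⟮𝓡 n, 𝓡 n⟯ (sphere (0 : V) 1),
      ∀ y : EuclideanSpace ℝ (Fin n), ‖y‖ ≤ 1 → Ψ ((stereographic' n v).symm y) = e y := by
  set σ := stereographic' n v with hσ
  -- the open set where `σ ∘ e` is a smooth map of `ℝⁿ`
  set W : Set (EuclideanSpace ℝ (Fin n)) := {y | e y ≠ v} with hW
  have hWo : IsOpen W := isOpen_compl_singleton.preimage hec.continuous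
  have hvne : -v ≠ v := (ne_neg_of_mem_unit_sphere ℝ v).symm
  have h0W : (0 : EuclideanSpace ℝ (Fin n)) ∈ W := by
    show e 0 ≠ v
    rw [hv]; exact hvne
  have hFm : ContMDiffOn (𝓡 n) (𝓡 n) ∞ (σ ∘ e) W :=
    (contMDiffOn_stereographic' v).comp hec.contMDiffOn fun y hy ↦ hy
  have hF : ContDiffOn ℝ ∞ (σ ∘ e) W := contMDiffOn_iff_contDiffOn.mp hFm
  have hF0 : (σ ∘ e) 0 = 0 := by
    rw [comp_apply, hv, hσ, ← stereographic'_symm_zero (n := n) v, stereographic'_stereographic'_symm]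
  -- `F₁ := L⁻¹ ∘ σ ∘ e` is tangent to the identity at `0`
  set F₁ : EuclideanSpace ℝ (Fin n) → EuclideanSpace ℝ (Fin n) :=
    (L.symm : EuclideanSpace ℝ (Fin n) → EuclideanSpace ℝ (Fin n)) ∘ (σ ∘ e) with hF₁
  have hF₁c : ContDiffOn ℝ ∞ F₁ W := L.symm.contDiff.comp_contDiffOn hF
  have hF₁0 : F₁ 0 = 0 := by
    show L.symm ((σ ∘ e) 0) = 0
    rw [hF0, map_zero]
  have hDF₁ : fderiv ℝ F₁ 0 = ContinuousLinearMap.id ℝ (EuclideanSpace ℝ (Fin n)) := by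
    have h1 : HasFDerivAt F₁ ((L.symm : EuclideanSpace ℝ (Fin n) →L[ℝ] EuclideanSpace ℝ (Fin n)).comp
        (L : EuclideanSpace ℝ (Fin n) →L[ℝ] EuclideanSpace ℝ (Fin n))) 0 :=
      (L.symm : EuclideanSpace ℝ (Fin n) →L[ℝ] EuclideanSpace ℝ (Fin n)).hasFDerivAt.comp 0 hL
    rw [ContinuousLinearEquiv.coe_symm_comp_coe] at h1
    exact h1.fderiv
  obtain ⟨r, hr, hrW, G, hG1, hG2⟩ :=
    exists_diffeomorph_eq_of_fderiv_eq_id hWo h0W hF₁c hF₁0 hDF₁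
  -- (I1) `e = σ⁻¹ ∘ L ∘ G` on `B̄(0, r)`
  have hI1 : ∀ y : EuclideanSpace ℝ (Fin n), ‖y‖ ≤ r → e y = σ.symm (L (G y)) := by
    intro y hy
    have hyW : y ∈ W := hrW (mem_closedBall_zero_iff.mpr (by linarith))
    rw [hG1 y (mem_closedBall_zero_iff.mpr hy)]
    simp only [hF₁, comp_apply, ContinuousLinearEquiv.apply_symm_apply]
    exact (stereographic'_symm_apply_of_ne v hyW).symm
  -- a bound for `G` on `B̄(0, r)`
  obtain ⟨C, hC⟩ := (isCompact_closedBall (0 : EuclideanSpace ℝ (Fin n)) r).exists_bound_of_continuousOn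
    G.continuous.continuousOn
  set R₁ : ℝ := max C 1 with hR₁
  have hR₁0 : 0 < R₁ := lt_of_lt_of_le one_pos (le_max_right _ _)
  have hGb : ∀ y : EuclideanSpace ℝ (Fin n), ‖y‖ ≤ r → ‖G y‖ ≤ R₁ := fun y hy ↦
    (hC y (mem_closedBall_zero_iff.mpr hy)).trans (le_max_left _ _)
  -- compactly supported diffeomorphisms realising `L` on `B̄(0, R₁)` and `r •` on `B̄(0, 1)`
  obtain ⟨sL, RL, hsL1, hsL2⟩ := hLs.exists_eq_on_closedBall_radius hR₁0
  obtain ⟨t, Rt, ht1, ht2⟩ :=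
    (IsStraightenable.smul_id (E := EuclideanSpace ℝ (Fin n)) hr).exists_eq_on_closedBall_radius
      one_pos
  have ht1' : ∀ y : EuclideanSpace ℝ (Fin n), ‖y‖ ≤ 1 → t y = r • y := fun y hy ↦ by
    rw [ht1 y hy]; rfl
  -- `u := sL ∘ G ∘ t`, compactly supported
  set u : EuclideanSpace ℝ (Fin n) ≃ₘ⟮𝓡 n, 𝓡 n⟯ EuclideanSpace ℝ (Fin n) := (t.trans G).trans sL
    with hu
  have hu_apply : ∀ y, u y = sL (G (t y)) := fun y ↦ rfl
  have hu_supp : ∀ y : EuclideanSpace ℝ (Fin n), max Rt (max (2 * r) RL) ≤ ‖y‖ → u y = y := by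
    intro y hy
    rw [hu_apply, ht2 y ((le_max_left _ _).trans hy),
      hG2 y ((le_max_left _ _).trans ((le_max_right _ _).trans hy)),
      hsL2 y ((le_max_right _ _).trans ((le_max_right _ _).trans hy))]
  -- (I2) `σ⁻¹ ∘ u = e ∘ (r •)` on `B̄(0, 1)`
  have hI2 : ∀ y : EuclideanSpace ℝ (Fin n), ‖y‖ ≤ 1 → σ.symm (u y) = e (r • y) := by
    intro y hy
    have hry : ‖r • y‖ ≤ r := by
      rw [norm_smul, Real.norm_of_nonneg hr.le]; nlinarith
    rw [hu_apply, ht1' y hy, hsL1 _ (hGb _ hry), hI1 _ hry]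
    rfl
  -- transport `u` along the chart `σ`
  obtain ⟨Hu, hHu, -⟩ := exists_diffeomorph_chartTransport (φ := σ)
    (by rw [hσ, stereographic'_source]; exact contMDiffOn_stereographic' v)
    (contMDiff_stereographic'_symm v) (by rw [hσ, stereographic'_target]) u hu_supp
  -- transport `t` along the chart `e⁻¹`
  obtain ⟨Ht, hHt, -⟩ := exists_diffeomorph_chartTransport (φ := Φ) hΦc
    (by rw [hΦe]; exact hec) hΦt t ht2
  rw [hΦe] at hHt
  -- `Ψ ∘ σ⁻¹ = e` on `B̄(0, 1)`
  set Ψ := Hu.trans Ht.symm with hΨ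
  have hΨ' : ∀ y : EuclideanSpace ℝ (Fin n), ‖y‖ ≤ 1 → Ψ (σ.symm y) = e y := by
    intro y hy
    simp only [hΨ, Diffeomorph.coe_trans, comp_apply]
    rw [hHu, hI2 y hy, ← ht1' y hy, ← hHt y, Diffeomorph.symm_apply_apply]
  exact ⟨Ψ, hΨ'⟩

/-- **Palais' disc theorem in a sphere** (Palais 1960, Thm. B; Hirsch, *Differential Topology*
(1976), Ch. 8, Thm. 3.1, for `k = n`, `M = Sⁿ`): **every smoothly embedded closed `n`-disc in the
`n`-sphere is standard up to a diffeomorphism of the sphere and an isometry of the disc.** For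
every smooth embedding `e : ℝⁿ → S` of the model space into the unit sphere `S` of an
`(n+1)`-dimensional real inner product space there are a diffeomorphism `Ψ : S ≃ S` and a linear
isometry `B` of `ℝⁿ` such that `Ψ (σᵥ⁻¹ y) = e (B y)` whenever `‖y‖ ≤ 1`, where `v = -e 0` and
`σᵥ⁻¹ = (stereographic' n v).symm` is the inverse stereographic projection from the pole `v`
(the standard disc centred at `e 0`). The isometry `B` records whether `e` preserves or
reverses orientation relative to `σᵥ⁻¹` and cannot be omitted in general. Proof: Hirsch's, in
the flow-free form of `PalaisBallComplement.lean` — pivot by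
`exists_linearIsometryEquiv_isStraightenable_comp`, then the straightenable case.
[cite: Palais1960, Thm. B] [cite: HirschDT1976, Ch. 8 Thm. 3.1] -/
theorem exists_diffeomorph_apply_stereographic_symm_eq
    {e : EuclideanSpace ℝ (Fin n) → sphere (0 : V) 1}
    (he : Manifold.IsSmoothEmbedding (𝓡 n) (𝓡 n) ∞ e) :
    ∃ (Ψ : (sphere (0 : V) 1) ≃ₘ⟮𝓡 n, 𝓡 n⟯ (sphere (0 : V) 1))
      (B : EuclideanSpace ℝ (Fin n) ≃ₗᵢ[ℝ] EuclideanSpace ℝ (Fin n)),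
      ∀ y : EuclideanSpace ℝ (Fin n), ‖y‖ ≤ 1 →
        Ψ ((stereographic' n (-e 0)).symm y) = e (B y) := by
  set v : sphere (0 : V) 1 := -e 0 with hv'
  have hv : e 0 = -v := by rw [hv', neg_neg]
  set σ := stereographic' n v with hσ
  have hvne : -v ≠ v := (ne_neg_of_mem_unit_sphere ℝ v).symm
  -- the chart `Φ = e⁻¹` of `S`
  obtain ⟨Φ, hΦt, hΦe, hΦs, hΦc⟩ := exists_chart_of_isSmoothEmbedding he
  -- `T := σ ∘ e` as a partial homeomorphism of `ℝⁿ`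
  set T := Φ.symm.trans σ with hT
  have hTcoe : (T : EuclideanSpace ℝ (Fin n) → EuclideanSpace ℝ (Fin n)) = σ ∘ e := by
    rw [hT, OpenPartialHomeomorph.coe_trans, hΦe]
  have hTsymm : (T.symm : EuclideanSpace ℝ (Fin n) → EuclideanSpace ℝ (Fin n)) = Φ ∘ σ.symm := by
    rw [hT, OpenPartialHomeomorph.coe_trans_symm, OpenPartialHomeomorph.symm_symm]
  have h0T : (0 : EuclideanSpace ℝ (Fin n)) ∈ T.source := by
    rw [hT, OpenPartialHomeomorph.trans_source, OpenPartialHomeomorph.symm_source, hΦt, hΦe, hσ,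
      stereographic'_source]
    refine ⟨mem_univ _, ?_⟩
    show e 0 ∈ ({v}ᶜ : Set (sphere (0 : V) 1))
    rw [hv]; exact hvne
  have hT0 : T 0 = 0 := by
    rw [hTcoe, comp_apply, hv, hσ, ← stereographic'_symm_zero (n := n) v,
      stereographic'_stereographic'_symm]
  -- smoothness of `σ ∘ e` near `0` and of `Φ ∘ σ⁻¹` near `0`
  set W : Set (EuclideanSpace ℝ (Fin n)) := {y | e y ≠ v} with hW
  have hWo : IsOpen W := isOpen_compl_singleton.preimage he.contMDiff.continuous
  have h0W : (0 : EuclideanSpace ℝ (Fin n)) ∈ W := by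
    show e 0 ≠ v
    rw [hv]; exact hvne
  have hFm : ContMDiffOn (𝓡 n) (𝓡 n) ∞ (σ ∘ e) W :=
    (contMDiffOn_stereographic' v).comp he.contMDiff.contMDiffOn fun y hy ↦ hy
  have hTd : DifferentiableAt ℝ T 0 := by
    rw [hTcoe]
    exact ((contMDiffOn_iff_contDiffOn.mp hFm).contDiffAt (hWo.mem_nhds h0W)).differentiableAt
      (by simp)
  have hTsd : DifferentiableAt ℝ T.symm (T 0) := by
    rw [hT0, hTsymm]
    have h1 : ContMDiffAt (𝓡 n) (𝓡 n) ∞ Φ (σ.symm 0) := by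
      refine hΦc.contMDiffAt (Φ.open_source.mem_nhds ?_)
      rw [hΦs, hσ, stereographic'_symm_zero, ← hv]
      exact mem_range_self 0
    have h2 : ContMDiffAt (𝓡 n) (𝓡 n) ∞ (Φ ∘ σ.symm) 0 :=
      h1.comp 0 (contMDiff_stereographic'_symm v 0)
    exact (contMDiffAt_iff_contDiffAt.mp h2).differentiableAt (by simp)
  obtain ⟨L, hL⟩ := OpenPartialHomeomorph.exists_hasFDerivAt_equiv T h0T hTd hTsd
  rw [hTcoe] at hL
  -- pivot: after an isometry `S₀` of the source the derivative is straightenable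
  obtain ⟨S₀, hS₀⟩ := exists_linearIsometryEquiv_isStraightenable_comp L
  set D : EuclideanSpace ℝ (Fin n) ≃ₘ⟮𝓡 n, 𝓡 n⟯ EuclideanSpace ℝ (Fin n) :=
    S₀.toContinuousLinearEquiv.toDiffeomorph with hD
  have hDcoe : (D : EuclideanSpace ℝ (Fin n) → EuclideanSpace ℝ (Fin n)) = S₀ := rfl
  have heS : ContMDiff (𝓡 n) (𝓡 n) ∞ (e ∘ S₀) := he.contMDiff.comp (hDcoe ▸ D.contMDiff)
  obtain ⟨Φ', hΦ't, hΦ'e, -, hΦ'c⟩ := exists_chart_symm_eq_comp hΦc hΦt D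
  rw [hΦe, hDcoe] at hΦ'e
  have hvS : (e ∘ S₀) 0 = -v := by rw [comp_apply, LinearIsometryEquiv.map_zero, hv]
  have hcoe : ((S₀.toContinuousLinearEquiv.trans L :
      EuclideanSpace ℝ (Fin n) ≃L[ℝ] EuclideanSpace ℝ (Fin n)) :
      EuclideanSpace ℝ (Fin n) →L[ℝ] EuclideanSpace ℝ (Fin n)) =
      (L : EuclideanSpace ℝ (Fin n) →L[ℝ] EuclideanSpace ℝ (Fin n)).comp
        (S₀ : EuclideanSpace ℝ (Fin n) →L[ℝ] EuclideanSpace ℝ (Fin n)) := by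
    ext y : 1
    rfl
  have hLS : HasFDerivAt (σ ∘ (e ∘ S₀))
      ((S₀.toContinuousLinearEquiv.trans L : EuclideanSpace ℝ (Fin n) ≃L[ℝ] EuclideanSpace ℝ (Fin n)) :
        EuclideanSpace ℝ (Fin n) →L[ℝ] EuclideanSpace ℝ (Fin n)) 0 := by
    have h1 : HasFDerivAt (σ ∘ e) (L : EuclideanSpace ℝ (Fin n) →L[ℝ] EuclideanSpace ℝ (Fin n))
        ((S₀ : EuclideanSpace ℝ (Fin n) →L[ℝ] EuclideanSpace ℝ (Fin n)) 0) := by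
      rwa [map_zero]
    rw [hcoe]
    exact h1.comp 0 (S₀ : EuclideanSpace ℝ (Fin n) →L[ℝ] EuclideanSpace ℝ (Fin n)).hasFDerivAt
  obtain ⟨Ψ, hΨ⟩ := exists_diffeomorph_apply_stereographic_symm_eq_of_isStraightenable heS Φ'
    hΦ't hΦ'e hΦ'c hvS _ hLS (by rw [hcoe]; exact hS₀)
  exact ⟨Ψ, S₀, fun y hy ↦ hΨ y hy⟩

end Literature.Topology.FourManifolds

end
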